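import Mathlib
import Summits.Langlands.Langlands.Theorems.PicardMuOrdinaryResidualAutomorphyEvenPairingInduction

/-!
# The cubic resolvent tower of a quartic over `K = ℚ(ω)` (Stage A of `ResidualAutomorphyEven`)

Helper file for item stmt-Langlands-13760 (route `PicardMuOrdinary`).  For `f ∈ ℤ[X]` we set up, over
`K = CyclotomicField 3 ℚ`:

* `fK f = f ⊗ K`, its splitting field `M f` over `K` (a number field, Galois over `K` when `f ⊗ K` is
  separable), the root set `R f ⊆ M f` and the faithful permutation action of `G f = Gal(M f / K)` on
  it (Mathlib `Polynomial.Gal.galActionHom`);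
* after fixing a bijection `R f ≃ Fin 4` (when `f ⊗ K` is a separable quartic), the permutation
  representation `perm4 : G f →* Perm (Fin 4)` and, through `Pairing.act` of the pairing file, the
  action of `G f` on the three pairings of the roots;
* the stabiliser `stabPairing ≤ G f` of the pairing `0`, its fixed field `E ⊇ K` (the **cubic
  resolvent extension**, `[E : K] = 3` when `12 ∣ #G f`), the element
  `s = a₄ (r₀ + r₁ - r₂ - r₃) ∈ M` on which the stabiliser acts through the block-sign character `ε`,
  and `δ = s² ∈ 𝓞_E`, a non-square in `E` (so `E(√δ) = M^{ker ε}` is the quadratic extension cut out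
  by `ε`, and `ε` becomes the quadratic Hecke character `quadraticHeckeChar δ` of `E`).

Everything here is unconditional field theory.
-/

set_option linter.dupNamespace false -- project-wide option (lakefile weak.linter.dupNamespace); `Summit.Langlands.Langlands` is the mandated namespace

noncomputable section

namespace Summit.Langlands.Langlands.Theorems.ResidualAutomorphyEven

open Polynomial Equiv Pairing

/-- The base field `K = ℚ(ω)` of the route. -/
abbrev K : Type := CyclotomicField 3 ℚ

variable (f : ℤ[X])

/-- `f ⊗ K`: the quartic viewed over `K`. -/
abbrev fK : K[X] := f.map (algebraMap ℤ K)

/-- The splitting field `M` of `f` over `K` (the compositum `L·K` of the splitting field `L` of `f`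
over `ℚ` with `K`). -/
abbrev M : Type := (fK f).SplittingField

/-- `M` is a number field (finite over the number field `K`). -/
instance instNumberFieldM : NumberField (M f) := NumberField.of_module_finite K (M f)

/-- The Galois group `G = Gal(M/K)` (as `K`-algebra automorphisms of `M`; this is Mathlib's
`Polynomial.Gal (fK f)` as a type, with the `AlgEquiv.aut` group structure). -/
abbrev G : Type := M f ≃ₐ[K] M f

/-- `f ⊗ K` splits in its splitting field (the `Fact` consumed by `Polynomial.Gal.galAction`). -/
instance instFactSplits : Fact (((fK f).map (algebraMap K (M f))).Splits) :=
  ⟨SplittingField.splits (fK f)⟩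

/-- The set of roots of `f` in `M`. -/
abbrev R : Type := (fK f).rootSet (M f)

/-- The hypothesis under which the root set has four elements: `f ⊗ K` is a separable quartic.
Bundled as a `Type`-valued record (its two fields are propositions, so it is a subsingleton): it is
the parameter on which the DATA below (`rootEnum`, `rt`, `perm4`, `E`, …) depend, and a
`Prop`-valued predicate in a `Theorems` file would read as an unregistered proposition. -/
structure IsSepQuartic (f : Polynomial ℤ) : Type where
  /-- `f ⊗ K` has degree `4`. -/
  natDegree_eq : (fK f).natDegree = 4
  /-- `f ⊗ K` is separable. -/
  separable : (fK f).Separable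

variable {f}

/-- `M/K` is Galois for separable `f ⊗ K`. -/
theorem isGalois_M (h : IsSepQuartic f) : IsGalois K (M f) :=
  IsGalois.of_separable_splitting_field (p := fK f) h.2

/-- A separable quartic has exactly four roots in its splitting field. -/
theorem card_R (h : IsSepQuartic f) : Fintype.card (R f) = 4 := by
  rw [← h.1]
  exact card_rootSet_eq_natDegree h.2 (SplittingField.splits (fK f))

/-- A chosen enumeration `R f ≃ Fin 4` of the roots (noncomputable choice). -/
def rootEnum (h : IsSepQuartic f) : R f ≃ Fin 4 :=
  Fintype.equivFinOfCardEq (card_R h)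

/-- The `i`-th root `rᵢ ∈ M` in the chosen enumeration. -/
def rt (h : IsSepQuartic f) (i : Fin 4) : M f := ((rootEnum h).symm i : M f)

/-- The roots are pairwise distinct. -/
theorem rt_injective (h : IsSepQuartic f) : Function.Injective (rt h) :=
  Subtype.val_injective.comp (rootEnum h).symm.injective

/-- The permutation representation of `G = Gal(M/K)` on `Fin 4 ≃ roots`: Mathlib's
`Polynomial.Gal.galActionHom` (precomposed with `Gal.restrict`, whose action on the roots is
evaluation by `Gal.restrict_smul`) transported along `rootEnum`.  Irreducible (so that the decision
procedures of the pairing file are never unfolded on it); use `smul_rt`. -/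
irreducible_def perm4 (h : IsSepQuartic f) : G f →* Perm (Fin 4) :=
  (rootEnum h).permCongrHom.toMonoidHom.comp
    ((Gal.galActionHom (fK f) (M f)).comp (Gal.restrict (fK f) (M f)))

/-- **`G` permutes the roots through `perm4`**: `g rᵢ = r_{perm4 g i}`. -/
theorem smul_rt (h : IsSepQuartic f) (g : G f) (i : Fin 4) : g (rt h i) = rt h (perm4 h g i) := by
  rw [perm4_def, rt, rt]
  change g _ = (((rootEnum h).symm ((rootEnum h) (Gal.restrict (fK f) (M f) g • (rootEnum h).symm i))
    : R f) : M f)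
  rw [Equiv.symm_apply_apply, Gal.restrict_smul]

/-- `perm4` is faithful: an automorphism of the splitting field is determined by its action on
the roots (`Polynomial.Gal.ext`). -/
theorem perm4_injective (h : IsSepQuartic f) : Function.Injective (perm4 h) := by
  intro g g' hgg'
  refine Gal.ext (fK f) fun x hx => ?_
  have h1 := smul_rt h g (rootEnum h ⟨x, hx⟩)
  have h2 := smul_rt h g' (rootEnum h ⟨x, hx⟩)
  rw [hgg'] at h1
  rw [rt, Equiv.symm_apply_apply] at h1 h2
  exact h1.trans h2.symm

/-- The **action of `G` on the three pairings** of the roots, as a homomorphism to `Perm (Fin 3)`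
(`Pairing.actHom ∘ perm4`). -/
def pairingPerm (h : IsSepQuartic f) : G f →* Perm Pairing := Pairing.actHom.comp (perm4 h)

/-- Unfolding `pairingPerm`. -/
theorem pairingPerm_apply (h : IsSepQuartic f) (g : G f) (p : Pairing) :
    pairingPerm h g p = act (perm4 h g) p := by
  rw [pairingPerm, MonoidHom.comp_apply, actHom_apply]

/-- The stabiliser `H ≤ G` of the pairing `0 = {{r₀, r₁}, {r₂, r₃}}` (a `D₈ ∩ G`). -/
def stabPairing (h : IsSepQuartic f) : Subgroup (G f) :=
  (MulAction.stabilizer (Perm Pairing) (0 : Pairing)).comap (pairingPerm h)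

/-- Membership in the stabiliser of the pairing `0`. -/
theorem mem_stabPairing (h : IsSepQuartic f) (g : G f) :
    g ∈ stabPairing h ↔ act (perm4 h g) 0 = 0 := by
  rw [stabPairing, Subgroup.mem_comap, MulAction.mem_stabilizer_iff, Perm.smul_def, pairingPerm_apply]

/-- The **cubic resolvent extension** `E = M^H ⊇ K` (for `12 ∣ #G`: the field `K(r₀r₁ + r₂r₃)`,
of degree `3` over `K`, `stabPairing_index`). -/
abbrev E (h : IsSepQuartic f) : IntermediateField K (M f) := IntermediateField.fixedField (stabPairing h)

/-! ### Counting: `A₄ ≤ G ≤ S₄`, `[G : H] = 3`, `[E : K] = 3` -/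

/-- `#G ∣ 24 = #S₄` (faithfulness of `perm4`). -/
theorem card_G_dvd (h : IsSepQuartic f) : Nat.card (G f) ∣ 24 := by
  have := Subgroup.card_dvd_of_injective (perm4 h) (perm4_injective h)
  rwa [Nat.card_eq_fintype_card (α := Perm (Fin 4)), Fintype.card_perm, Fintype.card_fin] at this

/-- The image of `G` in `S₄` has as many elements as `G`. -/
theorem card_range_perm4 (h : IsSepQuartic f) : Nat.card (perm4 h).range = Nat.card (G f) :=
  (Nat.card_congr (Equiv.ofInjective (perm4 h) (perm4_injective h))).symm

/-- **`A₄ ≤ G`**: if `12 ∣ #G` the image of `G` in `S₄` has index `≤ 2`, hence contains the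
alternating group (`Equiv.Perm.alternatingGroup_le_of_index_le_two`). -/
theorem alternatingGroup_le_range (h : IsSepQuartic f) (h12 : 12 ∣ Nat.card (G f)) :
    alternatingGroup (Fin 4) ≤ (perm4 h).range := by
  apply Equiv.Perm.alternatingGroup_le_of_index_le_two
  have hmul := (perm4 h).range.index_mul_card
  rw [card_range_perm4, Nat.card_eq_fintype_card (α := Perm (Fin 4)), Fintype.card_perm,
    Fintype.card_fin] at hmul
  obtain ⟨k, hk⟩ := h12
  rw [hk] at hmul
  have hk0 : 0 < k := by
    rcases Nat.eq_zero_or_pos k with rfl | hk0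
    · have := Nat.card_pos (α := G f); omega
    · exact hk0
  have : (perm4 h).range.index * k = 2 := by
    have h24 : (24 : ℕ) = Nat.factorial 4 := by decide
    nlinarith [hmul]
  nlinarith

/-- Every even permutation of the roots is realised by an element of `G` (when `12 ∣ #G`). -/
theorem exists_perm4_eq (h : IsSepQuartic f) (h12 : 12 ∣ Nat.card (G f)) (σ : Perm (Fin 4))
    (hσ : Perm.sign σ = 1) : ∃ g : G f, perm4 h g = σ :=
  alternatingGroup_le_range h h12 (Equiv.Perm.mem_alternatingGroup.mpr hσ)

/-- **`[G : H] = 3`**: `G` permutes the three pairings transitively (already `A₄` does). -/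
theorem index_stabPairing (h : IsSepQuartic f) (h12 : 12 ∣ Nat.card (G f)) :
    (stabPairing h).index = 3 := by
  letI : MulAction (G f) Pairing := MulAction.compHom Pairing (pairingPerm h)
  have hstab : stabPairing h = MulAction.stabilizer (G f) (0 : Pairing) := by
    ext g
    rw [mem_stabPairing, MulAction.mem_stabilizer_iff, MulAction.compHom_smul_def, Perm.smul_def,
      pairingPerm_apply]
  haveI : MulAction.IsPretransitive (G f) Pairing := by
    refine ⟨fun p q => ?_⟩
    obtain ⟨σ, hσ, hσp⟩ := exists_even_act_zero_eq p
    obtain ⟨τ, hτ, hτq⟩ := exists_even_act_zero_eq q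
    obtain ⟨a, ha⟩ := exists_perm4_eq h h12 σ hσ
    obtain ⟨b, hb⟩ := exists_perm4_eq h h12 τ hτ
    refine ⟨b * a⁻¹, ?_⟩
    rw [MulAction.compHom_smul_def, Perm.smul_def, pairingPerm_apply, map_mul, map_inv, hb, ha,
      ← hσp, ← act_mul, inv_mul_cancel_right, hτq]
  rw [hstab, MulAction.index_stabilizer_of_transitive, Nat.card_eq_fintype_card, Fintype.card_fin]

/-- `#H ≠ 0`. -/
theorem card_stabPairing_pos (h : IsSepQuartic f) : 0 < Nat.card (stabPairing h) :=
  Nat.card_pos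

/-- **`[E : K] = 3`**: the cubic resolvent extension is cubic (Galois correspondence:
`[M : E] = #H`, `[M : K] = #G = 3 · #H`). -/
theorem finrank_E (h : IsSepQuartic f) (h12 : 12 ∣ Nat.card (G f)) : Module.finrank K (E h) = 3 := by
  haveI := isGalois_M h
  have h1 : Module.finrank (E h) (M f) = Nat.card (stabPairing h) :=
    IntermediateField.finrank_fixedField_eq_card (stabPairing h)
  have h2 : Module.finrank K (M f) = Nat.card (G f) := (IsGalois.card_aut_eq_finrank K (M f)).symm
  have h3 := Module.finrank_mul_finrank K (E h) (M f)
  have h4 := (stabPairing h).index_mul_card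
  rw [index_stabPairing h h12] at h4
  rw [h1, h2, ← h4] at h3
  have := card_stabPairing_pos h
  nlinarith

/-! ### The element `s = a₄ (r₀ + r₁ - r₂ - r₃)` and `δ = s² ∈ E` -/

/-- `rᵢ` is a root of `f`. -/
theorem aeval_rt (h : IsSepQuartic f) (i : Fin 4) : aeval (rt h i) f = 0 := by
  have := (mem_rootSet.mp ((rootEnum h).symm i).2).2
  rwa [aeval_map_algebraMap] at this

/-- The leading coefficient `a₄` of `f`, in `M`. -/
def lc (f : ℤ[X]) : M f := algebraMap ℤ (M f) f.leadingCoeff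

/-- `a₄ ≠ 0` in `M` for `f ≠ 0`. -/
theorem lc_ne_zero (hf : f.leadingCoeff ≠ 0) : lc f ≠ 0 := fun h0 =>
  hf ((algebraMap ℤ (M f)).injective_int (h0.trans (map_zero _).symm))

/-- The element `s = a₄ (r₀ + r₁ - r₂ - r₃) = a₄ ∑ᵢ eᵢ rᵢ ∈ M` (`e` the signed indicator of the
pairing `0`); it is an algebraic integer and spans the block-sign character of the stabiliser. -/
def sElt (h : IsSepQuartic f) : M f := ∑ i : Fin 4, (signVec i : M f) * (lc f * rt h i)

/-- `a₄ rᵢ` is an algebraic integer (`isIntegral_leadingCoeff_smul`). -/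
theorem isIntegral_lc_mul_rt (h : IsSepQuartic f) (i : Fin 4) : IsIntegral ℤ (lc f * rt h i) := by
  have := isIntegral_leadingCoeff_smul (p := f) (x := rt h i) (aeval_rt h i)
  rwa [Algebra.smul_def] at this

/-- `s` is an algebraic integer. -/
theorem isIntegral_sElt (h : IsSepQuartic f) : IsIntegral ℤ (sElt h) := by
  refine IsIntegral.sum _ fun i _ => IsIntegral.mul ?_ (isIntegral_lc_mul_rt h i)
  rw [← eq_intCast (algebraMap ℤ (M f))]
  exact isIntegral_algebraMap

/-- `G` fixes `a₄`. -/
theorem smul_lc (g : G f) : g (lc f) = lc f := by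
  rw [lc, IsScalarTower.algebraMap_apply ℤ K (M f)]
  exact AlgHomClass.commutes g _

/-- How `G` moves `s`: `g s = a₄ ∑ᵢ eᵢ r_{perm4 g i}`. -/
theorem map_sElt (h : IsSepQuartic f) (g : G f) :
    g (sElt h) = ∑ i : Fin 4, (signVec i : M f) * (lc f * rt h (perm4 h g i)) := by
  simp only [sElt, map_sum, map_mul, map_intCast, smul_lc, smul_rt h g]

/-- **The stabiliser acts on `s` through the block sign**: `g s = ε(g) s` for `g ∈ H`. -/
theorem smul_sElt (h : IsSepQuartic f) {g : G f} (hg : act (perm4 h g) 0 = 0) :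
    g (sElt h) = (blockSign (perm4 h g) 0 : M f) * sElt h := by
  have hR : (blockSign (perm4 h g) 0 : M f) * sElt h =
      ∑ j, (signVec ((perm4 h g).symm j) : M f) * (lc f * rt h j) := by
    rw [sElt, Finset.mul_sum]
    refine Finset.sum_congr rfl fun j _ => ?_
    rw [signVec_symm_apply _ hg, Int.cast_mul, mul_assoc]
  rw [map_sElt, hR,
    ← Equiv.sum_comp (perm4 h g) (fun j => (signVec ((perm4 h g).symm j) : M f) * (lc f * rt h j))]
  simp only [Equiv.symm_apply_apply]

/-- **`s ≠ 0`** when `A₄ ≤ G`: otherwise `r₀ + r₁ = r₂ + r₃`, and applying the three-cycle `(1 2 3) ∈ G`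
gives `r₀ + r₂ = r₃ + r₁`, whence `r₁ = r₂`, contradicting separability. -/
theorem sElt_ne_zero (h : IsSepQuartic f) (h12 : 12 ∣ Nat.card (G f)) (hlc : f.leadingCoeff ≠ 0) :
    sElt h ≠ 0 := by
  obtain ⟨hsgn, h0, h1, h2, h3⟩ := cycle123_spec
  obtain ⟨sv0, sv1, sv2, sv3⟩ := signVec_val
  obtain ⟨g, hg⟩ := exists_perm4_eq h h12 _ hsgn
  intro hs
  have hs' := congrArg g hs
  rw [map_zero, map_sElt, hg] at hs'
  rw [sElt] at hs
  simp only [Fin.sum_univ_four, h0, h1, h2, h3, sv0, sv1, sv2, sv3, Int.cast_one, Int.cast_neg,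
    one_mul] at hs hs'
  have key : lc f * (rt h 1 - rt h 2) * 2 = 0 := by linear_combination hs - hs'
  have h12' : rt h 1 = rt h 2 := by
    rcases mul_eq_zero.mp key with h' | h'
    · rcases mul_eq_zero.mp h' with h'' | h''
      · exact absurd h'' (lc_ne_zero hlc)
      · exact sub_eq_zero.mp h''
    · exact absurd h' two_ne_zero
  exact absurd (rt_injective h h12') (by decide)

/-- `δ = s²`. -/
def delta (h : IsSepQuartic f) : M f := sElt h ^ 2

/-- **`δ ∈ E`**: the stabiliser `H` moves `s` by a sign, hence fixes `s²`. -/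
theorem delta_mem_E (h : IsSepQuartic f) : delta h ∈ E h := by
  rw [IntermediateField.mem_fixedField_iff]
  intro g hg
  have hg' : act (perm4 h g) 0 = 0 := (mem_stabPairing h g).mp hg
  rw [delta, map_pow, smul_sElt h hg']
  rcases blockSign_eq_one_or (perm4 h g) 0 with h1 | h1 <;> rw [h1] <;> push_cast <;> ring

/-- `δ` as an element of the cubic field `E`. -/
def deltaE (h : IsSepQuartic f) : E h := ⟨delta h, delta_mem_E h⟩

/-- `δ` is an algebraic integer of `E`. -/
theorem isIntegral_deltaE (h : IsSepQuartic f) : IsIntegral ℤ (deltaE h) := by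
  have hM : IsIntegral ℤ (((E h).val.toRingHom.toIntAlgHom) (deltaE h)) := (isIntegral_sElt h).pow 2
  exact (isIntegral_algHom_iff ((E h).val.toRingHom.toIntAlgHom) (E h).val.toRingHom.injective).mp hM

/-- `δ ∈ 𝓞_E`. -/
def deltaInt (h : IsSepQuartic f) : NumberField.RingOfIntegers (E h) := ⟨deltaE h, isIntegral_deltaE h⟩

/-- **`δ` is not a square in `E`** (when `A₄ ≤ G` and `f ≠ 0`): a square root in `E` would be `±s`,
fixed by `H`, but some `g ∈ H` has `ε(g) = -1`, i.e. `g s = -s ≠ s`. -/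
theorem not_isSquare_deltaE (h : IsSepQuartic f) (h12 : 12 ∣ Nat.card (G f))
    (hlc : f.leadingCoeff ≠ 0) : ¬ IsSquare (deltaE h : E h) := by
  rintro ⟨t, ht⟩
  have hs0 := sElt_ne_zero h h12 hlc
  obtain ⟨σ, hσ, hσ0, hσε⟩ := exists_even_stab_blockSign_neg
  obtain ⟨g, hg⟩ := exists_perm4_eq h h12 σ hσ
  have hgs : g (sElt h) = -sElt h := by
    rw [smul_sElt h (by rw [hg]; exact hσ0), hg, hσε]; push_cast; ring
  have hgH : g ∈ stabPairing h := (mem_stabPairing h g).mpr (by rw [hg]; exact hσ0)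
  have hgt : g (t : M f) = t := (IntermediateField.mem_fixedField_iff _ _).mp t.2 g hgH
  have ht' : sElt h ^ 2 = (t : M f) ^ 2 := by
    have := congrArg (fun x : E h => (x : M f)) ht
    simpa [deltaE, delta, pow_two] using this
  have : (sElt h - t) * (sElt h + t) = 0 := by linear_combination ht'
  rcases mul_eq_zero.mp this with h1 | h1
  · have hst : sElt h = t := sub_eq_zero.mp h1
    have : g (sElt h) = sElt h := by rw [hst, hgt]
    have h2 : (2 : M f) * sElt h = 0 := by linear_combination -(hgs.symm.trans this)
    exact hs0 ((mul_eq_zero.mp h2).resolve_left two_ne_zero)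
  · have hst : sElt h = -t := eq_neg_of_add_eq_zero_left h1
    have : g (sElt h) = sElt h := by rw [hst, map_neg, hgt]
    have h2 : (2 : M f) * sElt h = 0 := by linear_combination -(hgs.symm.trans this)
    exact hs0 ((mul_eq_zero.mp h2).resolve_left two_ne_zero)

end Summit.Langlands.Langlands.Theorems.ResidualAutomorphyEven
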